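import Mathlib
import Summits.Ventures.DiscreteObjects.Mahler.CensusNewton
import Summits.Ventures.DiscreteObjects.Mahler.CensusListPoly
import Summits.Ventures.DiscreteObjects.Mahler.EngineSoundness

/-!
# The kernel census search and its soundness (venture `DiscreteObjects`, target L)

Cell `pub-namedobj`, seat `pub-namedobj-mahler-g12`. Framing: lottery ticket; floor = certified bounds/negative
ranges.

`censusSearch T d []` enumerates the half coefficient vectors `a = [c₁,…,c_d]` of the monic palindromic integer
polynomials `p = x^{2d} + c₁x^{2d-1} + ⋯ + c₁x + 1` whose power sums satisfy `|P_k(p)| ≤ T_k` for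
`k = 1, …, |T|` (nested: the range of `c_k` is read off Newton's recursion, `P_k = -k c_k - Σ_{i<k} c_i P_{k-i}`;
the remaining tests are applied at the leaves, lazily, so most leaves cost `d+1` power sums). SOUNDNESS
(`take_descCoeffList_mem_censusSearch`): if `p ∈ ℤ[X]` is monic palindromic of degree `2d ≥ 2` with `M(p) < B`
and the thresholds satisfy `2d - 2 + B^k + B^{-k} ≤ T_k + 1` (`ThresholdsValid`), then the half vector of `p`
IS in the search output — by `rec_even_powerSum_test` (the power-sum bound, mahler g2) and
`rootPowerSum_eq_head` (Newton, this seat). Also `eq_ofCoeffs_descCoeffList`: such a `p` is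
`ofCoeffs (1 :: descCoeffList p)` and `palC` of its half vector is `descCoeffList p`.
-/

namespace Summit.Ventures.DiscreteObjects.Mahler

open Polynomial

/-! ## Definitions (evaluated by the kernel) -/

/-- `passes T ps`: the lists have equal length and `|ps[j]| ≤ T[j]` for all `j` (short-circuiting). -/
def passes : List ℕ → List ℤ → Bool
  | [], [] => true
  | t :: ts, p :: ps => decide (p.natAbs ≤ t) && passes ts ps
  | _, _ => false

/-- The integer interval `[lo, hi]` as a list. -/
def icc (lo hi : ℤ) : List ℤ := (List.range (hi + 1 - lo).toNat).map fun j : ℕ => lo + (j : ℤ)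

/-- From the half vector `a = [c₁,…,c_d]` the full descending list `[c₁,…,c_d,c_{d-1},…,c₁,1]` of the
palindromic polynomial. -/
def palC (a : List ℤ) : List ℤ := a ++ (a.reverse.tail ++ [1])

/-- The nested search: `fuel` = number of coefficients still to choose, `pre` = those chosen so far. -/
def censusSearch (T : List ℕ) : ℕ → List ℤ → List (List ℤ)
  | 0, pre => if passes T (psumsRev (palC pre) T.length).reverse then [pre] else []
  | fuel + 1, pre =>
    (icc (-((((T.getD pre.length 0 : ℕ) : ℤ) +
              (List.zipWith (· * ·) pre (psumsRev pre pre.length)).sum) / ((pre.length + 1 : ℕ) : ℤ)))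
         ((((T.getD pre.length 0 : ℕ) : ℤ) -
              (List.zipWith (· * ·) pre (psumsRev pre pre.length)).sum) / ((pre.length + 1 : ℕ) : ℤ))).flatMap
      fun ak => censusSearch T fuel (pre ++ [ak])

/-- Validity of integer thresholds for half-degree `d` and measure bound `B`:
`2d - 2 + B^k + B^{-k} ≤ T_k + 1` for `1 ≤ k ≤ |T|`. -/
def ThresholdsValid (d : ℕ) (B : ℝ) (T : List ℕ) : Prop :=
  ∀ k, 1 ≤ k → k ≤ T.length → (2 * d - 2 : ℝ) + B ^ k + (B ^ k)⁻¹ ≤ (T.getD (k - 1) 0 : ℝ) + 1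

/-! ## List lemmas -/

/-- Membership in `icc`. -/
theorem mem_icc {lo hi a : ℤ} : a ∈ icc lo hi ↔ lo ≤ a ∧ a ≤ hi := by
  unfold icc
  rw [List.mem_map]
  constructor
  · rintro ⟨j, hj, rfl⟩
    rw [List.mem_range] at hj
    have : (j : ℤ) < ((hi + 1 - lo).toNat : ℤ) := by exact_mod_cast hj
    constructor
    · omega
    · have h2 := Int.toNat_of_nonneg (show 0 ≤ hi + 1 - lo by omega)
      omega
  · rintro ⟨h1, h2⟩
    refine ⟨(a - lo).toNat, ?_, ?_⟩
    · rw [List.mem_range]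
      have : a - lo < hi + 1 - lo := by omega
      exact (Int.toNat_lt_toNat (by omega)).mpr this
    · rw [Int.toNat_of_nonneg (by omega)]; ring

/-- `zipWith` ignores the part of the left list beyond the length of the right one. -/
theorem zipWith_take_left (f : ℤ → ℤ → ℤ) (l m : List ℤ) (n : ℕ) (h : m.length ≤ n) :
    List.zipWith f (l.take n) m = List.zipWith f l m := by
  induction l generalizing m n with
  | nil => simp
  | cons x l ih =>
    cases m with
    | nil => simp
    | cons y m =>
      cases n with
      | zero => simp at h
      | succ n =>
        rw [List.take_succ_cons, List.zipWith_cons_cons, List.zipWith_cons_cons, ih m n (by simpa using h)]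

/-- `getD` of a `take` below the cut. -/
theorem getD_take_of_lt (l : List ℤ) {n j : ℕ} (h : j < n) : (l.take n).getD j 0 = l.getD j 0 := by
  rw [List.getD_eq_getElem?_getD, List.getD_eq_getElem?_getD, List.getElem?_take_of_lt h]

/-- `newtonNext` only reads the first `|prev| + 1` entries of `cs`. -/
theorem newtonNext_take (cs prev : List ℤ) {m : ℕ} (h : prev.length < m) :
    newtonNext (cs.take m) prev = newtonNext cs prev := by
  unfold newtonNext
  rw [getD_take_of_lt cs h, zipWith_take_left _ cs prev m h.le]

/-- `psumsRev cs j` only reads the first `j` entries of `cs`. -/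
theorem psumsRev_take (cs : List ℤ) (m : ℕ) : ∀ j ≤ m, psumsRev (cs.take m) j = psumsRev cs j := by
  intro j hj
  induction j with
  | zero => rfl
  | succ j ih =>
    rw [psumsRev_succ, psumsRev_succ, ih (by omega), newtonNext_take cs _ (by rw [length_psumsRev]; omega)]

/-- `passes` from a pointwise bound. -/
theorem passes_of_forall (T : List ℕ) (l : List ℤ) (hlen : l.length = T.length)
    (h : ∀ j < T.length, (l.getD j 0).natAbs ≤ T.getD j 0) : passes T l = true := by
  induction T generalizing l with
  | nil =>
    cases l with
    | nil => rfl
    | cons _ _ => simp at hlen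
  | cons t ts ih =>
    cases l with
    | nil => simp at hlen
    | cons q qs =>
      have h0 := h 0 (by simp)
      simp only [List.getD_cons_zero] at h0
      have hrest : passes ts qs = true :=
        ih qs (by simpa using hlen) (fun j hj => by simpa using h (j + 1) (by simpa using hj))
      simp [passes, h0, hrest]

/-- Entry `j` of the reversed power-sum list is `P_{j+1}`. -/
theorem getD_reverse_psumsRev (cs : List ℤ) (K j : ℕ) (hj : j < K) :
    (psumsRev cs K).reverse.getD j 0 = (psumsRev cs (j + 1)).getD 0 0 := by
  rw [List.getD_eq_getElem?_getD, List.getElem?_reverse (by rw [length_psumsRev]; exact hj), length_psumsRev,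
    ← List.getD_eq_getElem?_getD, getD_psumsRev cs K _ (by omega), show K - (K - 1 - j) = j + 1 by omega]

/-- In `palC a`, the entries below `|a|` are those of `a`. -/
theorem getD_palC_of_lt (a : List ℤ) {j : ℕ} (h : j < a.length) : (palC a).getD j 0 = a.getD j 0 := by
  unfold palC; rw [List.getD_append _ _ _ _ h]

/-- `(palC a).take j = a.take j` for `j ≤ |a|`. -/
theorem take_palC (a : List ℤ) {j : ℕ} (h : j ≤ a.length) : (palC a).take j = a.take j := by
  unfold palC; rw [List.take_append_of_le_length h]

/-! ## Soundness of the search -/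

/-- The head power sum `P_k` at level `k ≤ |a|` splits as `-(k · a_k) - S` with `S` computed from the prefix. -/
theorem head_psumsRev_palC (a : List ℤ) (k : ℕ) (hk1 : 1 ≤ k) (hk : k ≤ a.length) :
    (psumsRev (palC a) k).getD 0 0 =
      -(((k : ℕ) : ℤ) * a.getD (k - 1) 0) -
        (List.zipWith (· * ·) (a.take (k - 1)) (psumsRev (a.take (k - 1)) (k - 1))).sum := by
  obtain ⟨j, rfl⟩ : ∃ j, k = j + 1 := ⟨k - 1, by omega⟩
  rw [psumsRev_succ, List.getD_cons_zero, newtonNext, length_psumsRev, show j + 1 - 1 = j from rfl,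
    getD_palC_of_lt a (by omega)]
  congr 1
  rw [← psumsRev_take (palC a) j j le_rfl, take_palC a (by omega),
    ← zipWith_take_left _ (palC a) _ j (by rw [length_psumsRev]), take_palC a (by omega)]

/-- **Soundness of `censusSearch` (list form).** If `|a| = d ≤ |T|` and `|P_k| ≤ T_k` for all `1 ≤ k ≤ |T|`
(power sums of `palC a` by Newton's recursion), then `a ∈ censusSearch T d []`. -/
theorem mem_censusSearch {T : List ℕ} {d : ℕ} (hdT : d ≤ T.length) (a : List ℤ) (ha : a.length = d)
    (hpass : ∀ k, 1 ≤ k → k ≤ T.length → ((psumsRev (palC a) k).getD 0 0).natAbs ≤ T.getD (k - 1) 0) :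
    a ∈ censusSearch T d [] := by
  suffices H : ∀ fuel pre, pre.length + fuel = d → pre = a.take pre.length → a ∈ censusSearch T fuel pre by
    exact H d [] (by simp) (by simp)
  intro fuel
  induction fuel with
  | zero =>
    intro pre hlen hpre
    have hpa : pre = a := by rw [hpre]; exact List.take_of_length_le (by omega)
    subst hpa
    have hleaf : passes T (psumsRev (palC pre) T.length).reverse = true := by
      apply passes_of_forall _ _ (by simp)
      intro j hj
      rw [getD_reverse_psumsRev _ _ _ hj]
      exact hpass (j + 1) (by omega) (by omega)
    simp [censusSearch, hleaf]
  | succ fuel ih =>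
    intro pre hlen hpre
    rw [censusSearch, List.mem_flatMap]
    have hka : pre.length + 1 ≤ a.length := by omega
    have hPk := hpass (pre.length + 1) (by omega) (by omega)
    rw [head_psumsRev_palC a (pre.length + 1) (by omega) hka, Nat.add_sub_cancel, ← hpre] at hPk
    set S := (List.zipWith (· * ·) pre (psumsRev pre pre.length)).sum with hS
    set ak := a.getD pre.length 0 with hak
    set kz : ℤ := ((pre.length + 1 : ℕ) : ℤ) with hkz
    set Tk : ℤ := ((T.getD pre.length 0 : ℕ) : ℤ) with hTk
    have h1 : |(-(kz * ak) - S)| ≤ Tk := by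
      rw [Int.abs_eq_natAbs, hTk]; exact_mod_cast hPk
    obtain ⟨hlo, hhi⟩ := abs_le.mp h1
    have hkpos : (0 : ℤ) < kz := by rw [hkz]; exact_mod_cast Nat.succ_pos _
    refine ⟨ak, ?_, ?_⟩
    · rw [mem_icc]
      constructor
      · rw [neg_le, Int.le_ediv_iff_mul_le hkpos, show -ak * kz = -(kz * ak) by ring]
        linarith
      · rw [Int.le_ediv_iff_mul_le hkpos, mul_comm]
        linarith
    · apply ih (pre ++ [ak]) (by simp; omega)
      rw [List.length_append, List.length_singleton, List.take_succ_eq_append_getElem (by omega), ← hpre, hak,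
        List.getD_eq_getElem _ _ (by omega)]

/-- The top level of the search, unfolded: the first coefficient ranges over `[-T₁, T₁]`. -/
theorem mem_censusSearch_succ_nil_iff {T : List ℕ} {f : ℕ} {a : List ℤ} :
    a ∈ censusSearch T (f + 1) [] ↔
      ∃ a1 ∈ icc (-((T.getD 0 0 : ℕ) : ℤ)) ((T.getD 0 0 : ℕ) : ℤ), a ∈ censusSearch T f [a1] := by
  rw [censusSearch, List.mem_flatMap]
  simp

/-! ## From polynomials to the search -/

/-- Lists of integers with the same length and the same `getD` entries are equal. -/
theorem list_ext_of_getD {l l' : List ℤ} (hlen : l.length = l'.length)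
    (h : ∀ i < l.length, l.getD i 0 = l'.getD i 0) : l = l' :=
  List.ext_getElem hlen fun i h1 h2 => by
    have := h i h1
    rwa [List.getD_eq_getElem _ _ h1, List.getD_eq_getElem _ _ h2] at this

/-- `getD` of a `tail`. -/
theorem getD_tail (l : List ℤ) (i : ℕ) : l.tail.getD i 0 = l.getD (i + 1) 0 := by
  cases l <;> simp

/-- `getD` of a `reverse`. -/
theorem getD_reverse_of_lt (l : List ℤ) {i : ℕ} (h : i < l.length) :
    l.reverse.getD i 0 = l.getD (l.length - 1 - i) 0 := by
  rw [List.getD_eq_getElem?_getD, List.getElem?_reverse h, ← List.getD_eq_getElem?_getD]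

/-- The length of `palC a` is `2|a|` for nonempty `a`. -/
theorem length_palC (a : List ℤ) (ha : 1 ≤ a.length) : (palC a).length = 2 * a.length := by
  unfold palC
  rw [List.length_append, List.length_append, List.length_tail, List.length_reverse, List.length_singleton]
  omega

/-- For palindromic monic `p` of degree `2d`, `palC` of the half vector is the full descending list. -/
theorem palC_take_descCoeffList {p : ℤ[X]} {d : ℕ} (hd : 1 ≤ d) (hmonic : p.Monic) (hdeg : p.natDegree = 2 * d)
    (hpal : ∀ j ≤ 2 * d, p.coeff j = p.coeff (2 * d - j)) :
    palC ((descCoeffList p).take d) = descCoeffList p := by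
  set L := descCoeffList p with hL
  have hLlen : L.length = 2 * d := by rw [hL, length_descCoeffList, hdeg]
  set a := L.take d with ha
  have halen : a.length = d := by rw [ha, List.length_take, hLlen]; omega
  have hLget : ∀ j, L.getD j 0 = if j + 1 ≤ 2 * d then p.coeff (2 * d - (j + 1)) else 0 := by
    intro j; rw [hL, getD_descCoeffList, descCoeff, hdeg]
  apply list_ext_of_getD (by rw [length_palC a (by omega), halen, hLlen])
  intro i hi
  rw [length_palC a (by omega), halen] at hi
  by_cases h1 : i < d
  · rw [getD_palC_of_lt a (by omega), ha, getD_take_of_lt L h1]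
  · unfold palC
    rw [List.getD_append_right _ _ _ _ (by omega), halen]
    by_cases h2 : i < 2 * d - 1
    · rw [List.getD_append _ _ _ _ (by rw [List.length_tail, List.length_reverse, halen]; omega), getD_tail,
        getD_reverse_of_lt a (by rw [halen]; omega), halen, ha, getD_take_of_lt L (by omega), hLget, hLget,
        if_pos (by omega), if_pos (by omega), hpal (2 * d - (i + 1)) (by omega)]
      congr 1; omega
    · have hi2 : i = 2 * d - 1 := by omega
      rw [List.getD_append_right _ _ _ _ (by rw [List.length_tail, List.length_reverse, halen]; omega),
        List.length_tail, List.length_reverse, halen, show i - d - (d - 1) = 0 by omega, List.getD_cons_zero,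
        hLget, if_pos (by omega), hi2, show 2 * d - (2 * d - 1 + 1) = 0 by omega, hpal 0 (by omega), Nat.sub_zero,
        ← hdeg, hmonic.coeff_natDegree]

/-- A palindromic monic `p` of degree `2d` is `ofCoeffs (1 :: descCoeffList p)`. -/
theorem eq_ofCoeffs_descCoeffList {p : ℤ[X]} {d : ℕ} (hmonic : p.Monic) (hdeg : p.natDegree = 2 * d)
    (hpal : ∀ j ≤ 2 * d, p.coeff j = p.coeff (2 * d - j)) : p = ofCoeffs (1 :: descCoeffList p) := by
  ext j
  rw [coeff_ofCoeffs]
  cases j with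
  | zero => rw [List.getD_cons_zero, hpal 0 (by omega), Nat.sub_zero, ← hdeg, hmonic.coeff_natDegree]
  | succ j =>
    rw [List.getD_cons_succ, getD_descCoeffList, descCoeff, hdeg]
    split_ifs with h
    · rw [hpal (j + 1) h]
    · exact coeff_eq_zero_of_natDegree_lt (by omega)

/-- **Soundness of the search for polynomials.** A monic palindromic `p ∈ ℤ[X]` of degree `2d ≥ 2` with
`M(p) < B` has its half coefficient vector in `censusSearch T d []`, for any valid thresholds `T` (`|T| ≥ d`). -/
theorem take_descCoeffList_mem_censusSearch {p : ℤ[X]} {d : ℕ} (hd : 1 ≤ d) (hmonic : p.Monic)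
    (hdeg : p.natDegree = 2 * d) (hpal : ∀ j ≤ 2 * d, p.coeff j = p.coeff (2 * d - j)) {B : ℝ}
    (hB : intMahlerMeasure p < B) {T : List ℕ} (hdT : d ≤ T.length) (hT : ThresholdsValid d B T) :
    (descCoeffList p).take d ∈ censusSearch T d [] := by
  apply mem_censusSearch hdT _ (by rw [List.length_take, length_descCoeffList, hdeg]; omega)
  intro k hk1 hk2
  rw [palC_take_descCoeffList hd hmonic hdeg hpal]
  have hP := rec_even_powerSum_test p d hd hmonic hdeg hpal hB (k := k) (by omega)
  rw [← rootPowerSum_def, rootPowerSum_eq_head hmonic hk1, Complex.norm_intCast] at hP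
  have hTk := hT k hk1 hk2
  set N := (psumsRev (descCoeffList p) k).getD 0 0
  have h1 : (|N| : ℝ) < (T.getD (k - 1) 0 : ℝ) + 1 := lt_of_lt_of_le hP hTk
  have h2 : |N| < (T.getD (k - 1) 0 : ℤ) + 1 := by exact_mod_cast h1
  have h3 : (N.natAbs : ℤ) ≤ (T.getD (k - 1) 0 : ℤ) := by rw [Int.natCast_natAbs]; omega
  exact_mod_cast h3

end Summit.Ventures.DiscreteObjects.Mahler
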